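import Summits.BirchSwinnertonDyer.BirchSwinnertonDyer.Theorems.ByReductionTypeAtTwoFineSelmerConjAAtTwoAdditivePotGoodClassNumberOddCriterion
import HarnessLib

/-!
# An ODD-POWER class-number certificate for cubic fields: `h_K` odd from `I^k = (α)` (`k` odd) for the ideals of prime norm below the
# Minkowski bound — the `k = 3` criterion of k4-w1's `…ClassNumberOddCriterion` with the exponent freed (a `--supports 22618` toolkit file)

Cell `bsd-2adic`, rung K4, seat `bsd-2adic-k4-w3` GEN 11. HONEST FRAMING (D-0036/D-0054): UNCONDITIONAL kernel lemmas about cubic number fields;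
closes nothing; nothing booked; BSD is not proved by any of this.

PURPOSE. The C4″ census field of discriminant `−2856` (row 325584bk1) has `h = 7`: its class group is not killed by `3`, so
`odd_classNumber_of_cubeCertificate` cannot certify `2 ∤ h`. This file frees the exponent:

* `odd_classNumber_of_forall_pow_eq_one` — a finite abelian group in which every element satisfies `c^k = 1` for one ODD `k` has odd order
  (an element of order `2` would satisfy `c = c^k = 1`);
* `pow_eq_span_of_cert` — k4-w1's `pow_three_eq_span_of_cert` VERBATIM with `I³` replaced by `I^k`: an ideal `I` of prime norm `ℓ`
  has `I^k = (α)` (any `k`) once the certificate supplies, for the residue `a` of `θ` mod `I`, either a principal witness or a `k`-th-power witness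
  `ω = (x + yθ + zθ²)/m` (`ℓ ∣ x + ya + za²`, `|normPoly| = m³ℓ^k`, the Bézout identity `u·(x + yθ + zθ²) = (θ − a)^e + ℓ·w`, and `ℓ² ∤ g(a + ℓt)`);
* `odd_classNumber_of_powCertificate` — `M_K < B`, `k` odd, every ideal of prime norm `ℓ < B` has `I^k` principal ⟹ `h_K` odd.

References: [Marcus1977] Ch. 5 Thm. 35–37 and Cor. 2; [Cohen1993] §4.8.2, §6.3; k4-w1 `…ClassNumberOddCriterion` (kernel, `--supports 22615`).
-/

set_option autoImplicit false
-- sibling precedent (`…ClassNumberOddCriterion.lean`): the directory name repeats the summit name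
set_option linter.dupNamespace false

noncomputable section

open scoped Classical IntermediateField NumberField Real nonZeroDivisors

namespace Summit.BirchSwinnertonDyer.BirchSwinnertonDyer.Theorems.AddKatoTwo

open Polynomial IsDedekindDomain NumberField Matrix UniqueFactorizationMonoid

variable (K : Type) [Field K] [NumberField K]

/-! ## §1 Odd order from an odd exponent -/

omit [NumberField K] in
/-- **A finite class group in which every class satisfies `c^k = 1` for a fixed ODD `k` has odd order** (with `h_K = #Cl(𝓞 K)`): by Cauchy an
even order gives a class `c` of order `2`, and then `c = c^k = 1`. [folklore] -/
theorem odd_classNumber_of_forall_pow_eq_one [NumberField K] {k : ℕ} (hk : Odd k)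
    (h : ∀ c : ClassGroup (𝓞 K), c ^ k = 1) : Odd (NumberField.classNumber K) := by
  by_contra hodd
  rw [Nat.not_odd_iff_even, even_iff_two_dvd, NumberField.classNumber] at hodd
  haveI : Fact (Nat.Prime 2) := ⟨Nat.prime_two⟩
  obtain ⟨c, hc⟩ := exists_prime_orderOf_dvd_card 2 hodd
  obtain ⟨j, rfl⟩ := hk
  have h2 : c ^ 2 = 1 := by rw [← hc]; exact pow_orderOf_eq_one c
  have hck : c ^ (2 * j + 1) = c := by
    rw [pow_succ, pow_mul, h2, one_pow, one_mul]
  have hc1 : c = 1 := by rw [← hck]; exact h c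
  rw [hc1, orderOf_one] at hc
  exact absurd hc (by norm_num)

/-! ## §2 The `k`-th-power certificate -/

/-- **THE ODD-POWER CERTIFICATE** (`pow_three_eq_span_of_cert` with the exponent freed): an ideal `I` of prime norm `ℓ` has `I^k = (α)`
once the certificate supplies, for the residue `a` of `θ` mod `I` (a root of the cubic mod `ℓ`), EITHER a principal witness OR a
`k`-th-power witness: `ω = (x + yθ + zθ²)/m ∈ 𝓞 K` (`m` prime to `ℓ`) with `ℓ ∣ x + ya + za²`, `|normPoly(x, y, z)| = m³ℓ^k`, a Bézout identity
`(u₀ + u₁θ + u₂θ²)(x + yθ + zθ²) = (θ − a)^e + ℓ(w₀ + w₁θ + w₂θ²)` and an integer `t` with `ℓ² ∤ g(a + ℓt)`. Then `I` is the ONLY prime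
containing `ω` (another one, `Q`, would contain `ℓ` and `θ − a`, hence `θ − a − ℓt ∈ Q ⊓ I = Q·I`, whose norm `N(Q)·ℓ` would divide
`N(θ − a − ℓt) = ∓g(a + ℓt)`), so `(ω) = Iⁿ` with `ℓⁿ = ℓ^k`. Proof text = k4-w1's, `3 ↦ k`. KERNEL.
[cite: Marcus1977, Ch. 5 Thm. 37 and the worked examples after Cor. 2] [cite: Cohen1993, §4.8.2, §6.3] -/
theorem pow_eq_span_of_cert (h3 : Module.finrank ℚ K = 3) (b : 𝓞 K) {p q r : ℤ}
    (hirr : Irreducible (Cubic.toPoly ⟨1, (p : ℚ), q, r⟩)) (hb : b ^ 3 + p * b ^ 2 + q * b + r = 0)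
    {k : ℕ} {ℓ : ℕ} (hℓ : ℓ.Prime)
    (hcert : ∀ a : ℕ, a < ℓ → (ℓ : ℤ) ∣ (a : ℤ) ^ 3 + p * (a : ℤ) ^ 2 + q * a + r →
      (∃ x y z : ℤ, ∃ m : ℕ, Nat.Coprime m ℓ ∧ (ℓ : ℤ) ∣ x + y * a + z * (a : ℤ) ^ 2 ∧
        (∃ ω : 𝓞 K, (m : 𝓞 K) * ω = (x : 𝓞 K) + y * b + z * b ^ 2) ∧
        (x ^ 3 - p * x ^ 2 * y + (p ^ 2 - 2 * q) * x ^ 2 * z + q * x * y ^ 2 + (3 * r - p * q) * x * y * z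
          + (q ^ 2 - 2 * p * r) * x * z ^ 2 - r * y ^ 3 + p * r * y ^ 2 * z - q * r * y * z ^ 2 + r ^ 2 * z ^ 3).natAbs = m ^ 3 * ℓ) ∨
      (∃ x y z : ℤ, ∃ m : ℕ, Nat.Coprime m ℓ ∧ (ℓ : ℤ) ∣ x + y * a + z * (a : ℤ) ^ 2 ∧
        (∃ ω : 𝓞 K, (m : 𝓞 K) * ω = (x : 𝓞 K) + y * b + z * b ^ 2) ∧
        (x ^ 3 - p * x ^ 2 * y + (p ^ 2 - 2 * q) * x ^ 2 * z + q * x * y ^ 2 + (3 * r - p * q) * x * y * z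
          + (q ^ 2 - 2 * p * r) * x * z ^ 2 - r * y ^ 3 + p * r * y ^ 2 * z - q * r * y * z ^ 2 + r ^ 2 * z ^ 3).natAbs = m ^ 3 * ℓ ^ k ∧
        (∃ e : ℕ, ∃ u₀ u₁ u₂ w₀ w₁ w₂ : ℤ, ((u₀ : 𝓞 K) + u₁ * b + u₂ * b ^ 2) * ((x : 𝓞 K) + y * b + z * b ^ 2) =
          (b - (a : 𝓞 K)) ^ e + (ℓ : 𝓞 K) * ((w₀ : 𝓞 K) + w₁ * b + w₂ * b ^ 2)) ∧
        (∃ t : ℤ, ¬ ((ℓ : ℤ) ^ 2 ∣ ((a : ℤ) + ℓ * t) ^ 3 + p * ((a : ℤ) + ℓ * t) ^ 2 + q * ((a : ℤ) + ℓ * t) + r))))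
    {I : Ideal (𝓞 K)} (hI : Ideal.absNorm I = ℓ) : ∃ α : 𝓞 K, I ^ k = Ideal.span {α} := by
  have hℓI : ((ℓ : ℕ) : 𝓞 K) ∈ I := by have := Ideal.absNorm_mem I; rwa [hI] at this
  have hIprime : I.IsPrime := Ideal.isPrime_of_irreducible_absNorm (by rw [hI]; exact hℓ)
  have hI0 : I ≠ ⊥ := by intro h; rw [h, Ideal.absNorm_bot] at hI; exact hℓ.ne_zero hI.symm
  have hImax : I.IsMaximal := hIprime.isMaximal hI0
  obtain ⟨a, ha, hab⟩ := exists_sub_natCast_mem_of_absNorm_eq_prime K hℓ hI b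
  have hroot := natCast_dvd_of_sub_mem K hℓ hI h3 hb hab
  rcases hcert a ha hroot with ⟨x, y, z, m, hcop, hdvd, ⟨ω, hω⟩, hN⟩ |
      ⟨x, y, z, m, hcop, hdvd, ⟨ω, hω⟩, hN, ⟨e, u₀, u₁, u₂, w₀, w₁, w₂, hU⟩, ⟨t, hg2⟩⟩
  · -- `I = (ω)` is principal
    obtain ⟨hωI, hNω⟩ := mem_and_natAbs_norm_of_fracWitness K h3 b hirr hb hℓ hI hab hcop hdvd hω hN
    exact ⟨ω ^ k, by rw [eq_span_singleton_of_mem_of_absNorm_eq K hℓ.ne_zero hI hωI hNω, Ideal.span_singleton_pow]⟩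
  · obtain ⟨hωI, hNω⟩ := mem_and_natAbs_norm_of_fracWitness K h3 b hirr hb hℓ hI hab hcop hdvd hω hN
    -- `I` is the only prime containing `ω`
    have honly : ∀ Q : Ideal (𝓞 K), Q.IsPrime → Q ≠ ⊥ → ω ∈ Q → Q = I := by
      intro Q hQ hQ0 hωQ
      by_contra hne
      have hℓQ : ((ℓ : ℕ) : 𝓞 K) ∈ Q :=
        Literature.NumberTheory.NumberFields.MonicCubic.natCast_mem_of_norm_eq_pow hQ hωQ hNω
      have hTQ : ((x : 𝓞 K) + y * b + z * b ^ 2) ∈ Q := by rw [← hω]; exact Q.mul_mem_left _ hωQ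
      -- `θ − a ∈ Q` by the Bézout identity
      have hbaQ : b - (a : 𝓞 K) ∈ Q := by
        have h1 : ((u₀ : 𝓞 K) + u₁ * b + u₂ * b ^ 2) * ((x : 𝓞 K) + y * b + z * b ^ 2) ∈ Q := Q.mul_mem_left _ hTQ
        rw [hU] at h1
        have h2 : (ℓ : 𝓞 K) * ((w₀ : 𝓞 K) + w₁ * b + w₂ * b ^ 2) ∈ Q := Q.mul_mem_right _ hℓQ
        exact hQ.mem_of_pow_mem e (by simpa using Q.sub_mem h1 h2)
      -- the norm of `Q`
      obtain ⟨i, hi3, hNQ⟩ := (Nat.dvd_prime_pow hℓ).mp (absNorm_dvd_pow_three_of_natCast_mem K h3 hℓQ)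
      have hi1 : 1 ≤ i := by
        by_contra h0
        have hi0 : i = 0 := by omega
        rw [hi0, pow_zero, Ideal.absNorm_eq_one_iff] at hNQ
        exact hQ.ne_top hNQ
      -- `θ − (a + ℓt) ∈ Q ⊓ I = Q * I`
      have hQmax : Q.IsMaximal := hQ.isMaximal hQ0
      have hsup : Q ⊔ I = ⊤ := Ideal.IsMaximal.coprime_of_ne hQmax hImax hne
      have hprod : Q * I = Q ⊓ I := Ideal.mul_eq_inf_of_coprime hsup
      have hmem : b - (((a : ℤ) + ℓ * t : ℤ) : 𝓞 K) ∈ Q * I := by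
        have e : b - (((a : ℤ) + ℓ * t : ℤ) : 𝓞 K) = (b - (a : 𝓞 K)) - ((ℓ : ℕ) : 𝓞 K) * (t : 𝓞 K) := by push_cast; ring
        rw [hprod, e]
        exact ⟨Q.sub_mem hbaQ (Q.mul_mem_right _ hℓQ), I.sub_mem hab (I.mul_mem_right _ hℓI)⟩
      have hdvdN := Ideal.absNorm_dvd_absNorm_of_le ((Ideal.span_singleton_le_iff_mem _).mpr hmem)
      rw [map_mul, hNQ, hI, Ideal.absNorm_span_singleton] at hdvdN
      -- `N(θ − â) = ∓ g(â)`
      have hnb := natAbs_norm_coords_eq_natAbs_normPoly K h3 b hirr hb (-((a : ℤ) + ℓ * t)) 1 0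
      have e2 : (((-((a : ℤ) + ℓ * t)) : ℤ) : 𝓞 K) + ((1 : ℤ) : 𝓞 K) * b + ((0 : ℤ) : 𝓞 K) * b ^ 2 =
          b - (((a : ℤ) + ℓ * t : ℤ) : 𝓞 K) := by push_cast; ring
      rw [e2] at hnb
      rw [hnb] at hdvdN
      have hℓ2 : ℓ ^ 2 ∣ ℓ ^ i * ℓ := by
        rw [← pow_succ]; exact Nat.pow_dvd_pow ℓ (by omega)
      have hZ := Int.ofNat_dvd_left.mpr (hℓ2.trans hdvdN)
      apply hg2
      have e3 : (((a : ℤ) + ℓ * t) ^ 3 + p * ((a : ℤ) + ℓ * t) ^ 2 + q * ((a : ℤ) + ℓ * t) + r) =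
          -((-((a : ℤ) + ℓ * t)) ^ 3 - p * (-((a : ℤ) + ℓ * t)) ^ 2 * 1 + (p ^ 2 - 2 * q) * (-((a : ℤ) + ℓ * t)) ^ 2 * 0
            + q * (-((a : ℤ) + ℓ * t)) * 1 ^ 2 + (3 * r - p * q) * (-((a : ℤ) + ℓ * t)) * 1 * 0
            + (q ^ 2 - 2 * p * r) * (-((a : ℤ) + ℓ * t)) * 0 ^ 2 - r * 1 ^ 3 + p * r * 1 ^ 2 * 0 - q * r * 1 * 0 ^ 2
            + r ^ 2 * 0 ^ 3) := by ring
      rw [e3, Int.dvd_neg]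
      exact_mod_cast hZ
    -- hence `(ω) = I^k`
    have hω0 : ω ≠ 0 := by
      rintro rfl
      rw [Algebra.norm_zero, Int.natAbs_zero] at hNω
      exact pow_ne_zero k hℓ.ne_zero hNω.symm
    have hsp0 : Ideal.span {ω} ≠ ⊥ := by rwa [Ne, Ideal.span_singleton_eq_bot]
    set n := Multiset.card (normalizedFactors (Ideal.span {ω})) with hn
    have hfac : normalizedFactors (Ideal.span {ω}) = Multiset.replicate n I := by
      refine Multiset.eq_replicate.mpr ⟨rfl, fun Q hQ => ?_⟩
      have hQp : Q.IsPrime := Ideal.isPrime_of_prime (prime_of_normalized_factor Q hQ)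
      have hQ0 : Q ≠ ⊥ := (prime_of_normalized_factor Q hQ).ne_zero
      exact honly Q hQp hQ0 ((Ideal.span_singleton_le_iff_mem Q).mp (Ideal.le_of_dvd (dvd_of_mem_normalizedFactors hQ)))
    have hspan : Ideal.span {ω} = I ^ n := by
      rw [← Ideal.prod_normalizedFactors_eq_self hsp0, hfac, Multiset.prod_replicate]
    have hnk : n = k := by
      have h := congrArg Ideal.absNorm hspan
      rw [Ideal.absNorm_span_singleton, hNω, map_pow, hI] at h
      exact (Nat.pow_right_injective hℓ.one_lt h).symm
    exact ⟨ω, by rw [hspan, hnk]⟩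

/-! ## §3 Odd class number from `k`-th-power certificates -/

/-- **`h_K` is odd as soon as `M_K < B` and every ideal of prime norm `ℓ < B` has a principal `k`-th power, `k` odd** (cubic `K`). Every
class contains an ideal of norm `≤ M_K`; its prime factors `P` have `N(P) ∈ {ℓ, ℓ², ℓ³}` with `ℓ < B` and `P^k` principal (`N = ℓ²`:
`(ℓ) = P·J`, `J^k = (β)`, `ℓ^k = βγ`, `P^k = (γ)`; `N = ℓ³`: `P = (ℓ)`), so every class `c` has `c^k = 1` and the class number is odd
(`odd_classNumber_of_forall_pow_eq_one`). k4-w1's `odd_classNumber_of_cubeCertificate` with the exponent freed.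
[cite: Marcus1977, Ch. 5 Thm. 35–37 and Cor. 2] -/
theorem odd_classNumber_of_powCertificate (h3 : Module.finrank ℚ K = 3) {B : ℕ}
    (hM : (4 / π) ^ NumberField.InfinitePlace.nrComplexPlaces K *
      ((Module.finrank ℚ K).factorial / (Module.finrank ℚ K : ℝ) ^ Module.finrank ℚ K * √|(NumberField.discr K : ℝ)|) < B)
    {k : ℕ} (hk : Odd k)
    (hpow : ∀ ℓ : ℕ, ℓ < B → ℓ.Prime → ∀ I : Ideal (𝓞 K), Ideal.absNorm I = ℓ → ∃ α : 𝓞 K, I ^ k = Ideal.span {α}) :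
    Odd (NumberField.classNumber K) := by
  -- every non-zero prime of norm `< B` has a principal `k`-th power
  have hprime : ∀ P : Ideal (𝓞 K), P.IsPrime → P ≠ ⊥ → Ideal.absNorm P < B → ∃ α : 𝓞 K, P ^ k = Ideal.span {α} := by
    intro P hP hP0 hPB
    obtain ⟨ℓ, hℓ, hℓP, i, hi1, hi3, hN⟩ := exists_prime_natCast_mem K h3 hP hP0
    have hℓB : ℓ < B := lt_of_le_of_lt (by rw [hN]; exact Nat.le_self_pow (by omega) ℓ) hPB
    interval_cases i
    · rw [pow_one] at hN
      exact hpow ℓ hℓB hℓ P hN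
    · obtain ⟨J, hJ⟩ : P ∣ Ideal.span {((ℓ : ℕ) : 𝓞 K)} :=
        Ideal.dvd_iff_le.mpr ((Ideal.span_singleton_le_iff_mem P).mpr hℓP)
      have hNℓ : Ideal.absNorm (Ideal.span {((ℓ : ℕ) : 𝓞 K)}) = ℓ ^ 3 := by
        rw [Ideal.absNorm_span_singleton]
        have : ((ℓ : ℕ) : 𝓞 K) = algebraMap ℤ (𝓞 K) ℓ := by simp
        rw [this, Algebra.norm_algebraMap, NumberField.RingOfIntegers.rank, h3, Int.natAbs_pow]
        simp
      have hJN : Ideal.absNorm J = ℓ := by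
        have h := congrArg Ideal.absNorm hJ
        rw [hNℓ, map_mul, hN, pow_succ] at h
        exact (Nat.eq_of_mul_eq_mul_left (pow_pos hℓ.pos 2) h).symm
      obtain ⟨β, hβ⟩ := hpow ℓ hℓB hℓ J hJN
      have hkJ : Ideal.span {((ℓ : ℕ) : 𝓞 K) ^ k} = P ^ k * Ideal.span {β} := by
        rw [← Ideal.span_singleton_pow, hJ, mul_pow, hβ]
      have hmem : ((ℓ : ℕ) : 𝓞 K) ^ k ∈ Ideal.span {β} := by
        have : ((ℓ : ℕ) : 𝓞 K) ^ k ∈ P ^ k * Ideal.span {β} := by rw [← hkJ]; exact Ideal.mem_span_singleton_self _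
        exact Ideal.mul_le_left this
      obtain ⟨γ, hγ⟩ := Ideal.mem_span_singleton'.mp hmem
      have hβ0 : β ≠ 0 := by
        intro h0
        rw [h0] at hβ
        have : Ideal.absNorm (J ^ k) = 0 := by rw [hβ, Ideal.span_singleton_eq_bot.mpr rfl, Ideal.absNorm_bot]
        rw [map_pow, hJN] at this
        exact pow_ne_zero k hℓ.ne_zero this
      refine ⟨γ, mul_right_cancel₀ ((Ideal.span_singleton_eq_bot.not).mpr hβ0) ?_⟩
      rw [← hkJ, Ideal.span_singleton_mul_span_singleton, hγ]
    · have hnorm : (Algebra.norm ℤ ((ℓ : ℕ) : 𝓞 K)).natAbs = ℓ ^ 3 := by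
        have : ((ℓ : ℕ) : 𝓞 K) = algebraMap ℤ (𝓞 K) ℓ := by simp
        rw [this, Algebra.norm_algebraMap, NumberField.RingOfIntegers.rank, h3, Int.natAbs_pow]
        simp
      refine ⟨((ℓ : ℕ) : 𝓞 K) ^ k, ?_⟩
      rw [eq_span_singleton_of_mem_of_absNorm_eq K (pow_ne_zero 3 hℓ.ne_zero) hN hℓP hnorm, Ideal.span_singleton_pow]
  -- hence every class is killed by `k`
  refine odd_classNumber_of_forall_pow_eq_one K hk fun C => ?_
  set H : Subgroup (ClassGroup (𝓞 K)) := (powMonoidHom k : ClassGroup (𝓞 K) →* ClassGroup (𝓞 K)).ker with hH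
  obtain ⟨I, rfl, hI⟩ := NumberField.exists_ideal_in_class_of_norm_le C
  have hIB : Ideal.absNorm (I : Ideal (𝓞 K)) < B := by exact_mod_cast hI.trans_lt hM
  have hcl : Literature.NumberTheory.NumberFields.ClassIn H (I : Ideal (𝓞 K)) := by
    refine Literature.NumberTheory.NumberFields.ClassIn.of_prime_factors (nonZeroDivisors.coe_ne_zero I)
      fun Q hQ hQ0 hdvd => ?_
    have hQB : Ideal.absNorm Q < B :=
      lt_of_le_of_lt (Nat.le_of_dvd (Nat.pos_of_ne_zero (Ideal.absNorm_ne_zero_of_nonZeroDivisors I))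
        (Ideal.absNorm_dvd_absNorm_of_le (Ideal.le_of_dvd hdvd))) hIB
    obtain ⟨α, hα⟩ := hprime Q hQ hQ0 hQB
    intro hQ0'
    rw [hH, MonoidHom.mem_ker, powMonoidHom_apply, ← map_pow, ClassGroup.mk0_eq_one_iff]
    exact ⟨⟨α, by rw [SubmonoidClass.coe_pow]; exact hα⟩⟩
  have := hcl I.2
  simpa [hH, MonoidHom.mem_ker, powMonoidHom_apply] using this

end Summit.BirchSwinnertonDyer.BirchSwinnertonDyer.Theorems.AddKatoTwo

end
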